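import Mathlib
import Summits.Ventures.HodgeRepro0.P4K3LatticeDefsG

/-!
# P4K3LatticeG2 (seat p4) — one kernel-evaluated 19 × 19 integer matrix product of the K3-lattice certificate

See `P4K3LatticeDefsG` (and `DefsGp`, `DefsM`) for the data and the paper side (proofs/p4-k3-route-check.md §4). This module proves exactly one product
identity by `rfl` on `Matrix.mulᵣ` (kernel evaluation); the resource options are elaboration limits only, no checking-weakening option.
-/

namespace HodgeRepro0.P4K3Lattice

set_option maxRecDepth 100000 in
set_option maxHeartbeats 4000000 in
/-- `Q` is invertible over ℤ (kernel evaluation of the product). -/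
theorem Q_mul_Qinv : Q * Qinv = 1 := by
  rw [← Matrix.mulᵣ_eq, ← I19_eq]; rfl

end HodgeRepro0.P4K3Lattice
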